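import Summits.QuantumAdvantage.QuantumAdvantage.Theorems.CubicForrelationNearExactIsExactTwelveTypeOWindow
import Summits.QuantumAdvantage.QuantumAdvantage.Theorems.CubicForrelationNearExactIsExactTwelveLevelSixEngine
import Summits.QuantumAdvantage.QuantumAdvantage.Theorems.CubicForrelationNearExactIsExactTwelveLevelFiveEngine

/-!
# Crux `CubicForrelation.NearExactIsExact` (stmt-QuantumAdvantage-14043) — n = 12: `Φ ≥ 953/1024 ⇒ Φ = 1`, i.e. `θ₁₂ < 953/1024`

Certificate seat `b2b-cforr-cert` (gen 13).  HONEST FRAMING: a kernel-checked, DECIDABLE VERDICT about the finite slice `n = 12` of the crux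
(cubic Boolean pairs on 12 bits) — NOT summit progress.  The crux asks for one `θ < 1` isolating exactness on EVERY even number of bits; this
file only shrinks the undecided window at `n = 12` to `[912, 953)/1024` (from `[912, 960)/1024`, `theta_twelve_halfopen`, and `[912, 955)/1024`,
`theta_twelve_halfopen_955`): the seven values `953/1024, …, 959/1024` are NOT Forrelation values of cubic pairs on 12 bits.

THEOREMS: `isolation_twelve_953`, `theta_twelve_lt_953`, `theta_twelve_halfopen_953`, `no_window_twelve_953` (and `tw_isolation_953` at `Fin (6+6)`).

Assembly: `Φ ≥ 953/1024 > 59/64` forces `W_g ∈ 32ℤ` (`to12_window_typeE`, gen 12); a level-5 side (`W_g/32` odd somewhere) is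
`tw5_levelFive_window_all`, a level-`≥ 6` side is `tw6_levelSix_window_all`.  Both are ONE-SIDED in the partner (only `f` cubic is used) and
end with the `fl1` engine: once the wild part of the residual is shown to be even (wild-point parity + Reed–Muller on the abstract flat, and at
level 6 the Pfaffian parity `ws_sum4_mod8`), the sign digit satisfies (H3)/(H4), `fl1_flat_l1` bounds the `L¹` norm of its transform by `2¹³`,
and the pairing identity contradicts the budget.

WHAT IS OPEN at `n = 12` after this file: `θ₁₂ ∈ [912/1024, 953/1024)`.  At `952/1024` (slack `8` units) a 6-flat of odd wild points (level 5:
32 points of cost 8; level 6: the off-flat residual with `16` points of cost `4`, or `8 ∣ e ≠ 0` at one point) becomes affordable and passes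
every step used here; it needs a new input.

References: Ax (1964) / McEliece (1972); Hou (1998); Kasami–Tokura (1970); MacWilliams–Sloane (1977) Ch. 13–15; Carlet (2021); O'Donnell
(2014) §3.3.  Everything below is proved from Mathlib and the tree; axioms are the standard three.
-/

set_option linter.dupNamespace false -- D-0017: single-problem summit ⇒ `QuantumAdvantage.QuantumAdvantage` by design

noncomputable section

namespace Summit.QuantumAdvantage.QuantumAdvantage.Theorems.CubicForrelation.NearExactIsExact

open Finset
open Literature.Computability.QuantumComplexity
open Literature.Computability.QuantumComplexity.DerivativeWalsh (W)

/-! ### Assembly: `Φ ≥ 953/1024 ⇒ Φ = 1` on 12 bits -/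

/-- **`Φ ≥ 953/1024 ⇒ Φ = 1` for cubic pairs on `6 + 6` bits.**  Type O is excluded above `59/64` (`to12_window_typeE`), so the spectrum of
`g` lies in `32ℤ`; a level-5 side is handled by `tw5_levelFive_window_all`, a level-`≥ 6` side by `tw6_levelSix_window_all`.  NOT summit
progress. [this work] -/
theorem tw_isolation_953 (f g : (Fin (6 + 6) → Bool) → Bool) (hf : IsDegLeFun 3 f) (hg : IsDegLeFun 3 g)
    (hΦ : (953 / 1024 : ℝ) ≤ forrelation f g) : forrelation f g = 1 := by
  have hlo : (59 / 64 : ℝ) < forrelation f g := by linarith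
  obtain ⟨hgE, -⟩ := to12_window_typeE f g hf hg hlo
  choose u' hu' using hgE
  have hu'5 : ∀ x, W (fun y => signOf (g y)) x = (2 : ℝ) ^ 5 * (u' x : ℝ) := fun x => (hu' x).trans (by norm_num)
  by_cases hodd : ∃ x, Odd (u' x)
  · exact tw5_levelFive_window_all f g hf hg u' hu'5 hodd hΦ
  · push Not at hodd
    have hu6 := tw_level_up g u' hu'5 hodd
    exact tw6_levelSix_window_all f g hf hg (fun x => u' x / 2) (fun x => (hu6 x).trans (by norm_num)) hΦ

/-- **On 12 bits, `Φ ≥ 953/1024 ⇒ Φ = 1`** for all cubic `f, g : 𝔽₂¹² → 𝔽₂` (at the literal type `Fin 12`).  The tree had `960/1024 = 15/16`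
(`isolation_twelve_closed`) and `955/1024` (`isolation_twelve_955`); the seven values `953/1024, …, 959/1024` are excluded.  A kernel-checked,
decidable verdict about the finite slice `n = 12`; NOT summit progress. [this work] -/
theorem isolation_twelve_953 : ∀ f g : (Fin 12 → Bool) → Bool, IsDegLeFun 3 f → IsDegLeFun 3 g →
    (953 / 1024 : ℝ) ≤ forrelation f g → forrelation f g = 1 :=
  fun f g hf hg h => tw_isolation_953 f g hf hg h

/-- **`θ₁₂ < 953/1024`.** NOT summit progress. [this work] -/
theorem theta_twelve_lt_953 : ∃ θ : ℝ, θ < 953 / 1024 ∧ ∀ f g : (Fin 12 → Bool) → Bool, IsDegLeFun 3 f → IsDegLeFun 3 g →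
    θ < forrelation f g → forrelation f g = 1 :=
  fb_theta_lt_of_closed (n := 12) _ isolation_twelve_953

/-- **`θ₁₂ ∈ [57/64, 953/1024)`** (the tree had `[57/64, 15/16)`, then `[57/64, 955/1024)`). NOT summit progress. [this work] -/
theorem theta_twelve_halfopen_953 : ∃ θ₀ : ℝ, 57 / 64 ≤ θ₀ ∧ θ₀ < 953 / 1024 ∧
    IsLeast {θ : ℝ | ∀ f g : (Fin 12 → Bool) → Bool, IsDegLeFun 3 f → IsDegLeFun 3 g →
      θ < forrelation f g → forrelation f g = 1} θ₀ := by
  obtain ⟨θ₀, hθ₀⟩ := theta_exists 12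
  obtain ⟨θ', hθ', hiso⟩ := theta_twelve_lt_953
  exact ⟨θ₀, theta_twelve_bounds.2 θ₀ hθ₀.1, lt_of_le_of_lt (hθ₀.2 hiso) hθ', hθ₀⟩

/-- **No cubic pair on 12 bits has `Φ ∈ [953/1024, 1)`** — in particular none of the values `953/1024, …, 959/1024`. NOT summit progress.
[this work] -/
theorem no_window_twelve_953 : ¬ ∃ f g : (Fin 12 → Bool) → Bool, IsDegLeFun 3 f ∧ IsDegLeFun 3 g ∧
    (953 / 1024 : ℝ) ≤ forrelation f g ∧ forrelation f g < 1 := by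
  rintro ⟨f, g, hf, hg, hlo, hlt⟩
  have h := isolation_twelve_953 f g hf hg hlo
  linarith


end Summit.QuantumAdvantage.QuantumAdvantage.Theorems.CubicForrelation.NearExactIsExact

end
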